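import Literature.MathematicalPhysics.QuantumFieldTheory.Balaban1983to89.T3AlphaInputsACTwoRunLevel
import HarnessLib

/-!
# `Balaban1983to89.T3AlphaInputsACTrivRows` — the (α) socket, part 4: THE TRIVIAL-HISTORY INTERFACE ROWS the class-membership door (cell `ym3-torus`,
# UV3-NODE §69.2 ∕ §69.9 ∕ §69.10) reads and parts 1–3 do not name — `ChiOneOnSmall` (δ8), `TrivWeight` (R0), `ZtermTriv` (Z0), `EnlContains` (X ⊂ X̃),
# `LocBlockUnion` (δ1), `LocDiam` (δ4) — and the additive package `AlphaInputsT3ACFullTriv` (= `AlphaInputsT3ACFull ∧` the six; blast radius zero)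

Continues `T3AlphaInputsAC` (p452599) ∕ `T3AlphaInputsACSchemas` ∕ `T3AlphaInputsACTwoRunLevel`: same conventions — run-`K` level currency, hypothesis schemas ON EXPOSED
DATA, never asserted, no instance, no notation.  Requested by the cell `ym3-torus` (width seat px8, UV3-NODE §69.9 (1)∕§69.10 (2); ★★OWNER ruling pending on the lane): the six
predicates are EXACTLY the displayed binders `hχ1`, `hR0`, `hZ`, `hsub`, `hBU`, `hDiam` of the landed doors ✓`…S1aAlphaMemOfRows.mem_of_alphaRows` (p821956),
✓`…S1aAlphaMemVersionOfRows` (p822164), ✓`…S1aAlphaMemCanonVersionOfRows` (p822781), ✓`…S1aAlphaLocalCover` (p821836), ✓`…S1aAlphaFootDiam` (p821837), in the letters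
those files quantify over, so that a consumer holding `AlphaInputsT3ACFullTriv` feeds them BY NAME.

* §1 THE SIX ROWS, each with its printed source:
  `ChiOneOnSmall` — (47) p.267 «the characteristic function χ_k corresponds to the restrictions on V given by the conditions |U_k(∂p) − 1| < g_kp(g_k)η², p ⊂ T_η»
    read on the datum through [Balaban1985Variational] Thm 1 (9) (datum-small ⇒ minimiser-small; print's constant absorbed in `b₀`, exactly as `AdmOnSmall`);
    the ANTI-JUNK companion of `AdmOnSmall`: without it (47′) is preserved by `χ ↦ ε·χ`, `0 < ε < 1`, i.e. pins nothing (UV3-NODE §69.9 (2));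
  `TrivWeight` — (40)–(41) p.266 at the trivial region history (all `Ω_i = T_η`, all `Z_i = ∅`: no `ζ_Λ`, no δ-kernels, no lower characteristic functions; p.272
    «all simplifications coming from the fact that Ω_{k+1} = T_η»): the weight of (41) IS the top characteristic function `χ_k`;
  `ZtermTriv` — (41) p.266: `Σ_{j<k} O(log g_j⁻¹)|Z_j| = 0` when every `Z_j = ∅`;
  `EnlContains` — p.263 «X̃ = ∪_{□⊂X} □̃», `□̃` the cube with its neighbours: `X ⊆ X̃`;
  `LocBlockUnion` — (24) p.262 «Localizations X are connected unions of big blocks» of the `Lⁱη`-lattice (big blocks of side `M₁Lⁱ` fine steps), in the tree's own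
    `B10Eq38TorusDomains.IsBlockUnion (M₁·L^i)` (membership depends on a site only through its big block; «connected» is not needed by the cover count and is NOT
    demanded — cell ym3-torus px20 g21 11:23:19Z reading);
  `LocDiam` — (24) p.262 «a linear size 𝓛(X) … the length of a shortest tree graph connecting the centers of big blocks in X …, if the big blocks are scaled to unit
    cubes»: any two sites of a listed domain are within block pseudo-distance `CD·𝓛` at its scale (`CD` absorbs the unit conventions).
* §2 `AlphaInputsT3ACFullTriv D W b₀ p₀ ε₀ C68 Cχ B₃ M₁ r CD := AlphaInputsT3ACFull ∧ LocBlockVolume ∧ (∃ κ₁ C C′, TermSize C κ₁ ∧ LocCover κ₁ C′)` (ONE decay rate for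
  (44)∕(45), as print and `TwoRunLv`) `∧` the six `∧ EnlBounded M₁ r` (with `M₁` the block constant of `EnlBounded`∕`LocBlockUnion`∕`LocDiam`, `CD` the diameter constant), its
  projections, and `AlphaInputsT3ACFullTriv.base`.

HONEST SCOPE: hypothesis schemas over GIVEN data (`D`, `W`), inhabited by nobody here; NOTHING of [Balaban1985UV3] ∕ [Balaban1985Variational] is asserted or proved; the package for the
actual runs is the route's obligation (`stub_alphaOfLane`-type), not this file's; the six rows are READINGS of the cited sentences at the trivial history, flagged as such; no theorem
of the papers is restated (CITE-NOT-RESTATE: `lean search --decl` over `T3AlphaInputsAC*` finds none of the six as an existing predicate — nearest neighbours named per row).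
Cell `ym3-torus`'s rung R3 = SU(2) YM₃ on T³ at fixed lattice data — NOT d = 4, NOT infinite volume, NOT a mass gap, NOT Clay; the Yang–Mills mass gap is NOT proved.

References: T. Bałaban, CMP **102** (1985) 255–275 [Balaban1985UV3] ((24) p.262, p.263, (40)–(41) p.266, (47) p.267, p.272); CMP **102** (1985) 277–309
[Balaban1985Variational] (Thm 1 (9) p.279).
-/

set_option autoImplicit false

noncomputable section

open MeasureTheory
open Literature.MathematicalPhysics.QuantumFieldTheory.Balaban1983to89.T3ContinuumYM3Torus
open Literature.MathematicalPhysics.QuantumFieldTheory.Balaban1983to89.T3UnitScaleTilt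
open Literature.MathematicalPhysics.QuantumFieldTheory.Balaban1983to89.T3AlphaInputsAC
open Literature.MathematicalPhysics.QuantumFieldTheory.Balaban1983to89.T3AlphaInputsACSchemas
open Literature.MathematicalPhysics.QuantumFieldTheory.Balaban1983to89.T3AlphaInputsACTwoRunLevel (LocBlockVolume)
open Literature.MathematicalPhysics.QuantumFieldTheory.Balaban1983to89.B10Eq38TorusDomains (IsBlockUnion bdist)

namespace Literature.MathematicalPhysics.QuantumFieldTheory.Balaban1983to89.T3AlphaInputsACTrivRows

variable {F : T3Family} {γ : ℝ}

/-! ## §1 The six trivial-history interface rows -/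

section Rows

/-- **THE CHARACTERISTIC FUNCTION OF (47) IS ONE ON THE ROUTE'S WINDOW** (hypothesis schema, never asserted; δ8; the anti-junk companion of `AdmOnSmall`): a level-`j` datum
of run `K` all of whose plaquette variables are within `θBal(K − j) = g_jp(g_j)` of `1` has `χ_j = 1` — (47) p.267 «the characteristic function χ_k corresponds to the
restrictions on V given by the conditions |U_k(∂p) − 1| < g_kp(g_k)η², p ⊂ T_η» read on the datum through [Balaban1985Variational] Thm 1 (9) (print's constant absorbed in
`b₀`).  Without this clause (47′) pins nothing (`χ ↦ ε·χ` preserves `ChiRange`, `EnvelopeRegular`, `NoTrivOnLarge`, `Ineq47At`∕`Ineq47AE`).  EQUALS the displayed binder `hχ1` of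
✓`…S1aAlphaMemOfRows.mem_of_alphaRows` (p821956) ∕ ✓`…S1aAlphaMemVersionOfRows` (p822164) ∕ ✓`…S1aAlphaMemCanonVersionOfRows` (p822781) ∕ ✓`…S1aAlphaTwoSidedRep.lower_of_ineq47`
(p820217), quantified over `(K, j)`.  NEAREST EXISTING PREDICATE: `T3AlphaInputsAC.AdmOnSmall` (same binder shape, conclusion `D.Adm K j (D.triv K j) W` instead of `D.χ K j W = 1`;
neither implies the other as typed) and `ChiRange` (`0 ≤ χ ≤ 1`, no window clause). [cite: Balaban1985UV3, (47) p.267] -/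
def ChiOneOnSmall (D : AlphaDataT3 F γ) (b₀ p₀ : ℝ) : Prop :=
  ∀ K j (W : GaugeField (F.P K) j (Matrix.specialUnitaryGroup (Fin 2) ℂ)), j ≤ K → PlaqSmall (θBal F.L γ b₀ p₀ (K - j)) W → D.χ K j W = 1

/-- **THE LARGE-FIELD TERM VANISHES AT THE TRIVIAL HISTORY** (hypothesis schema on the exposed datum, never asserted; Z0): `Σ_{j<k} O(log g_j⁻¹)|Z_j| = 0` when every
`Z_j = ∅` — (41) p.266, the trivial history.  EQUALS the displayed binder `hZ` of p821956 ∕ p822164 ∕ p822781 ∕ ✓`…S1aAlphaTwoSidedRep.upper_of_ineq41` (p820217), quantified over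
`(K, j)`.  NEAREST EXISTING PREDICATE: none reads `Zterm` at the trivial history (`T3AlphaInputsAC` exposes `Zterm` as a free field; `up` uses it; no size row — cell UV3-NODE §69.2 δ9).
[cite: Balaban1985UV3, (41) p.266] -/
def ZtermTriv (D : AlphaDataT3 F γ) : Prop :=
  ∀ K j, D.Zterm K j (D.triv K j) = 0

/-- **A LOCALISATION LIES IN ITS ENLARGEMENT, `X ⊆ X̃`** (hypothesis schema on the exposed enlargement, never asserted): p.263 «X̃ = ∪_{□⊂X} □̃», `□̃` = the cube `□` with its
neighbours.  EQUALS the displayed binder `hsub` of p821956 ∕ p822164 ∕ p822781.  NEAREST EXISTING PREDICATE: `T3AlphaInputsAC.EnlBounded` (the other inclusion: `X̃` within `r` big blocks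
of `X`); together they pin `X̃` between `X` and its `r`-collar. [cite: Balaban1985UV3, p.263 after (26)] -/
def EnlContains (D : AlphaDataT3 F γ) : Prop :=
  ∀ K i (Y : Set (Site (F.P K) 0)), Y ⊆ D.enl K i Y

/-- **THE LISTED LOCALISATION DOMAINS ARE UNIONS OF BIG BLOCKS** (hypothesis schema, never asserted; δ1): every level-`i` domain of run `K` listed for a history is a union of
big blocks of side `M₁·Lⁱ` of the fine torus, in the tree's `B10Eq38TorusDomains.IsBlockUnion` (membership depends on a site only through its big block) — (24) p.262
«Localizations X are connected unions of big blocks»; connectedness is carried by `LocCover`'s decay and NOT demanded here.  EQUALS the displayed binder `hBU` of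
✓`…S1aAlphaLocalCover.localCount_le`∕`coverShape_of_alpha` (p821836) and of p821956 ∕ p822164 ∕ p822781, quantified over `(K, j, h, i)` (the doors read it at `h = triv`).  NEAREST
EXISTING PREDICATE: `T3AlphaInputsACTwoRunLevel.LocBlockVolume` (volume `≥ L^{3i}` only — implied by this row under `M₁ ∣ 2L^m` via ✓`…S1aAlphaLocalCover.pow_le_card_fiber`, not
conversely). [cite: Balaban1985UV3, (24) p.262] -/
def LocBlockUnion (D : AlphaDataT3 F γ) (M₁ : ℕ) : Prop :=
  ∀ K j (h : D.Hist K j) i, ∀ Y ∈ D.Loc K j h i, IsBlockUnion (M₁ * F.L ^ i) Y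

/-- **THE LINEAR SIZE BOUNDS THE DIAMETER** (hypothesis schema tying the exposed `treeLen` to the geometry, never asserted; δ4): any two sites of a listed level-`i` domain are
within block pseudo-distance `CD·𝓛(Y)` at scale `i` — (24) p.262 «a linear size 𝓛(X) of a localization X as the length of a shortest tree graph connecting the centers of big
blocks in X …, if the big blocks are scaled to unit cubes» (so any two blocks of `X` are within `𝓛(X)` block units; `CD` absorbs the unit conventions, `M₁` among them).  EQUALS the displayed binder `hDiam` of
✓`…S1aAlphaFootDiam.diamFoot_le` (p821837) and of p821956 ∕ p822164 ∕ p822781, quantified over `(K, j, h, i)`.  NEAREST EXISTING PREDICATE: none ties `treeLen` to geometry (`LocCover`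
reads `treeLen` only as a summability weight — cell UV3-NODE §69.2 δ4). [cite: Balaban1985UV3, (24) p.262] -/
def LocDiam (D : AlphaDataT3 F γ) (M₁ : ℕ) (CD : ℝ) : Prop :=
  ∀ K j (h : D.Hist K j) i, ∀ Y ∈ D.Loc K j h i, ∀ x ∈ Y, ∀ y ∈ Y, bdist (F.P K) M₁ i x y ≤ CD * D.treeLen K i Y

/-- **THE TRIVIAL REGION HISTORY's WEIGHT IS `χ_j`** (hypothesis schema on the opened history functional, never asserted; R0, the χ-support link's other half): at the
trivial region history (all `Ω_i = T_η`, all `Z_i = ∅`) the weight of (41) is the top characteristic function `χ_k(V)` alone — (40)–(41) p.266 at `Ω₁ = ⋯ = Ω_k = T_η`,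
p.272 «all simplifications coming from the fact that Ω_{k+1} = T_η»; with `LFSum` it makes the trivial term of `LF` equal to `low·e^{Zterm(triv)}`
(✓`T3AlphaInputsACHistorySplit.upTrivTerm_eq_low_mul`).  EQUALS the inline R0 hypothesis of the 19936∕18916 lineage VERBATIM (`hwt : ∀ K j v Wf, W.wt K j (W.trivReg K j) v Wf = D.χ K j Wf`,
e.g. ✓`…HistoryTailAlphaWeightDial.trivWt_wtScale`) and, at fixed `(K, j)`, the displayed binder `hR0` of p820217 ∕ p821956 ∕ p822164 ∕ p822781 (binder order `(W, v)` there).  NEAREST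
EXISTING PREDICATE: `NoTrivOnLarge` clause (ii) (the trivial weight VANISHES at a large plaquette; says nothing on the window). [cite: Balaban1985UV3, (40)-(41) p.266 and p.272] -/
def TrivWeight {D : AlphaDataT3 F γ} (W : LFData D) : Prop :=
  ∀ K j (v : (i : Fin j) → GaugeField (F.P K) i (Matrix.specialUnitaryGroup (Fin 2) ℂ)) (Wf : GaugeField (F.P K) j (Matrix.specialUnitaryGroup (Fin 2) ℂ)),
    W.wt K j (W.trivReg K j) v Wf = D.χ K j Wf

end Rows

/-! ## §2 The additive package -/

section Package

variable {D : AlphaDataT3 F γ}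

variable (D) in
/-- **THE FULL (α) PACKAGE WITH THE TRIVIAL-HISTORY INTERFACE ROWS** (hypothesis schema on GIVEN data, never asserted): `AlphaInputsT3ACFull ∧ LocBlockVolume ∧ (∃ κ₁ C C′, TermSize … C κ₁ ∧
LocCover κ₁ C′)` (print's ONE decay rate `κ` for (44) and (45) — `AlphaInputsT3AC` quantifies the two rates separately, as `TwoRunLv` already noted) `∧ ChiOneOnSmall ∧
TrivWeight ∧ ZtermTriv ∧ EnlContains ∧ LocBlockUnion M₁ ∧ LocDiam M₁ CD ∧ EnlBounded M₁ r` — one name for what the class-membership door of cell `ym3-torus` reads (additive: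
no consumer of `AlphaInputsT3AC(Full)` is touched). [cite: Balaban1985UV3, Thm 2 p.272, (41) p.266, (47) p.267 and (24) p.262] -/
def AlphaInputsT3ACFullTriv (W : LFData D) (b₀ p₀ ε₀ C68 Cχ B₃ : ℝ) (M₁ : ℕ) (r CD : ℝ) : Prop :=
  AlphaInputsT3ACFull D W b₀ p₀ ε₀ C68 Cχ B₃ ∧ LocBlockVolume D ∧ (∃ κ₁ C C' : ℝ, TermSize D b₀ p₀ C κ₁ ∧ LocCover D κ₁ C') ∧
    ChiOneOnSmall D b₀ p₀ ∧ TrivWeight W ∧ ZtermTriv D ∧ EnlContains D ∧ LocBlockUnion D M₁ ∧ LocDiam D M₁ CD ∧ EnlBounded D M₁ r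

namespace AlphaInputsT3ACFullTriv

variable {W : LFData D} {b₀ p₀ ε₀ C68 Cχ B₃ r CD : ℝ} {M₁ : ℕ} (h : AlphaInputsT3ACFullTriv D W b₀ p₀ ε₀ C68 Cχ B₃ M₁ r CD)
include h

/-- The full package. [cite: Balaban1985UV3, Thm 2 p.272] -/
theorem full : AlphaInputsT3ACFull D W b₀ p₀ ε₀ C68 Cχ B₃ := h.1

/-- The package. [cite: Balaban1985UV3, Thm 2 p.272] -/
theorem base : AlphaInputsT3AC D b₀ p₀ ε₀ C68 := h.1.base

/-- Block volume. [cite: Balaban1985UV3, (24) p.262] -/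
theorem locBlockVolume : LocBlockVolume D := h.2.1

/-- The common decay rate of (44) and (45). [cite: Balaban1985UV3, (44)-(45) p.267] -/
theorem commonRate : ∃ κ₁ C C' : ℝ, TermSize D b₀ p₀ C κ₁ ∧ LocCover D κ₁ C' := h.2.2.1

/-- δ8. [cite: Balaban1985UV3, (47) p.267] -/
theorem chiOneOnSmall : ChiOneOnSmall D b₀ p₀ := h.2.2.2.1

/-- R0. [cite: Balaban1985UV3, (41) p.266] -/
theorem trivWeight : TrivWeight W := h.2.2.2.2.1

/-- Z0. [cite: Balaban1985UV3, (41) p.266] -/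
theorem ztermTriv : ZtermTriv D := h.2.2.2.2.2.1

/-- `X ⊆ X̃`. [cite: Balaban1985UV3, p.263] -/
theorem enlContains : EnlContains D := h.2.2.2.2.2.2.1

/-- δ1. [cite: Balaban1985UV3, (24) p.262] -/
theorem locBlockUnion : LocBlockUnion D M₁ := h.2.2.2.2.2.2.2.1

/-- δ4. [cite: Balaban1985UV3, (24) p.262] -/
theorem locDiam : LocDiam D M₁ CD := h.2.2.2.2.2.2.2.2.1

/-- `X̃` bounded. [cite: Balaban1985UV3, p.263] -/
theorem enlBounded : EnlBounded D M₁ r := h.2.2.2.2.2.2.2.2.2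

end AlphaInputsT3ACFullTriv

end Package

end Literature.MathematicalPhysics.QuantumFieldTheory.Balaban1983to89.T3AlphaInputsACTrivRows

end
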